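import Mathlib
import Literature.MathematicalPhysics.QuantumLattice.OSContractionSemigroup
import Literature.Analysis.OperatorTheory.SemigroupJointSpectralMeasure
import HarnessLib

/-!
# Kernel vectors with dense span: relabelling operators and the energy–momentum pair

The abstract, definition-free half of the KERNEL-LEVEL Osterwalder–Schrader reconstruction
(Osterwalder–Schrader, CMP 31 (1973), §4.1; Glimm–Jaffe, *Quantum Physics* (1987), Thm. 6.1.3;
Berg–Christensen–Ressel, *Harmonic Analysis on Semigroups* (1984), §4.4): a complex Hilbert space `H`,
a family of **kernel vectors** `δ : X → H` whose finite linear combinations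
`Finsupp.linearCombination ℂ δ c` (`c : X →₀ ℂ`) are dense, and **relabellings** `σ : X → X` of the
index set acting by `Σ cₓ δₓ ↦ Σ cₓ δ_{σx}`. Everything is phrased with Mathlib's
`Finsupp.linearCombination`, so that no pre-Hilbert type synonym and no new definition is needed;
the kernel vectors of a positive semidefinite scalar kernel come from Mathlib's reproducing kernel
Hilbert space `RKHS.OfKernel` (Moore–Aronszajn / Kolmogorov decomposition, `KernelVectors.inner_kerFun_one`,
`KernelVectors.denseRange_lc_kerFun_one`).

## Contents (namespace `Literature.Analysis.OperatorTheory.KernelVectors`; all proved)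

* Gram formulas `⟪Σ cₓ δₓ, Σ c'ᵧ δᵧ⟫ = Σ conj cₓ c'ᵧ ⟪δₓ, δᵧ⟫` and their relabelled versions;
  `clm_eq_of_eq_on_lc` (operators are determined on the span).
* `exists_clm_of_norm_le`: a relabelling bounded on the span extends to a bounded operator
  (`LinearMap.extendOfNorm`; OS 1973, text after (4.9)); `inner_clm_left_of_symm` (kernel-symmetric
  relabellings give symmetric operators, OS (4.7)); `norm_clm_apply_of_inner_eq` (kernel-preserving
  relabellings give isometries, OS (4.5)).
* `norm_lc_mapDomain_le`: the Osterwalder–Schrader iteration (OS (4.8)–(4.9); GJ Thm. 6.1.3 (iii)):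
  a kernel-symmetric semigroup of relabellings with BOUNDED kernel entries is contractive on the span
  (the boundedness replaces the polynomial growth (4.8) of the distributional setting; the real
  sequence lemma is the tree's `le_of_sq_le_mul_succ`).
* Strong continuity from continuity of kernel entries, by density: `continuous_clm_apply_of_group`
  (isometric groups, OS (4.10)) and `continuous_clm_apply_of_semigroup` (symmetric contraction
  semigroups, GJ Thm. 6.1.3).
* `exists_isEnergyMomentumPair`: a kernel-symmetric semigroup `σ_t` with bounded continuous
  entries and a commuting kernel-preserving group `ρ_a` of relabellings of `ℝ^d`, trivial on the
  time axis, extend to an `IsEnergyMomentumPair (T, U)` (`SemigroupJointSpectralMeasure`), whose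
  joint spectral measure `IsEnergyMomentumPair.exists_measure_inner_transfer_translate_eq_integral`
  is then available at every vector.
* `posSemidef_smul_one`, `inner_kerFun_one`, `denseRange_lc_kerFun_one`: a scalar kernel `k` with
  `conj k(y,x) = k(x,y)` and `0 ≤ Re Σ conj cₓ cᵧ k(x,y)` gives, through `RKHS.OfKernel` of the
  operator-valued matrix `k(x,y) • 1`, kernel vectors `kerFun x 1` with dense span and Gram matrix `k`.

## Design notes and what is NOT here

The index set `X` is arbitrary (points of a half-space, test functions, configurations, …); the
time parameter of `σ` runs over `ℝ` with the junk convention `σ_t = σ_{t ∨ 0}` supplied by the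
user; `ρ` is indexed by `EuclideanSpace ℝ (Fin d)` as `IsEnergyMomentumPair` demands. NOT here: the
identification of a concrete kernel (done by the users, e.g. the pointwise kernels `K(θx − y)` of
reflection-positive functions on `ℝ⁴`), uniqueness of the extensions, the vacuum vector, field
operators.

## References
* K. Osterwalder, R. Schrader, *Axioms for Euclidean Green's functions*, CMP 31 (1973), §4.1,
  (4.5)–(4.10) and p. 92.
* J. Glimm, A. Jaffe, *Quantum Physics* (2nd ed. 1987), §6.1, Thm. 6.1.3.
* C. Berg, J. P. R. Christensen, P. Ressel, *Harmonic Analysis on Semigroups* (1984), §4.4.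
* V. Paulsen, M. Raghupathi, *An introduction to the theory of reproducing kernel Hilbert spaces*
  (2016), Thm. 2.14 (Moore's theorem; Mathlib `RKHS.OfKernel`).
-/

noncomputable section

open Filter ComplexConjugate
open scoped InnerProductSpace Topology

namespace Literature.Analysis.OperatorTheory

namespace KernelVectors

variable {X : Type*} {H : Type*} [NormedAddCommGroup H] [InnerProductSpace ℂ H]

/-! ## Gram formulas for finite linear combinations of kernel vectors -/

/-- Gram formula for two families: `⟪Σ cₓ δₓ, Σ c'ᵧ δ'ᵧ⟫ = Σₓ Σᵧ conj cₓ · c'ᵧ · ⟪δₓ, δ'ᵧ⟫`. [folklore] -/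
theorem inner_lc_lc' (δ δ' : X → H) (c c' : X →₀ ℂ) :
    ⟪Finsupp.linearCombination ℂ δ c, Finsupp.linearCombination ℂ δ' c'⟫_ℂ =
      ∑ x ∈ c.support, ∑ y ∈ c'.support, conj (c x) * c' y * ⟪δ x, δ' y⟫_ℂ := by
  rw [Finsupp.linearCombination_apply, Finsupp.sum, sum_inner]
  refine Finset.sum_congr rfl fun x _ => ?_
  rw [Finsupp.linearCombination_apply, Finsupp.sum, inner_sum]
  refine Finset.sum_congr rfl fun y _ => ?_
  rw [inner_smul_left, inner_smul_right]
  ring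

/-- Gram formula: `⟪Σ cₓ δₓ, Σ c'ᵧ δᵧ⟫ = Σₓ Σᵧ conj cₓ · c'ᵧ · ⟪δₓ, δᵧ⟫`. [folklore] -/
theorem inner_lc_lc (δ : X → H) (c c' : X →₀ ℂ) :
    ⟪Finsupp.linearCombination ℂ δ c, Finsupp.linearCombination ℂ δ c'⟫_ℂ =
      ∑ x ∈ c.support, ∑ y ∈ c'.support, conj (c x) * c' y * ⟪δ x, δ y⟫_ℂ :=
  inner_lc_lc' δ δ c c'

/-- Gram formula for relabelled combinations:
`⟪Σ cₓ δ_{σx}, Σ c'ᵧ δ_{τy}⟫ = Σₓ Σᵧ conj cₓ · c'ᵧ · ⟪δ_{σx}, δ_{τy}⟫`. [folklore] -/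
theorem inner_lc_mapDomain (δ : X → H) (σ τ : X → X) (c c' : X →₀ ℂ) :
    ⟪Finsupp.linearCombination ℂ δ (Finsupp.mapDomain σ c),
        Finsupp.linearCombination ℂ δ (Finsupp.mapDomain τ c')⟫_ℂ =
      ∑ x ∈ c.support, ∑ y ∈ c'.support, conj (c x) * c' y * ⟪δ (σ x), δ (τ y)⟫_ℂ := by
  rw [Finsupp.linearCombination_mapDomain, Finsupp.linearCombination_mapDomain, inner_lc_lc']
  rfl

/-- Gram formula with the second combination relabelled:
`⟪Σ cₓ δₓ, Σ c'ᵧ δ_{τy}⟫ = Σₓ Σᵧ conj cₓ · c'ᵧ · ⟪δₓ, δ_{τy}⟫`. [folklore] -/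
theorem inner_lc_lc_mapDomain (δ : X → H) (τ : X → X) (c c' : X →₀ ℂ) :
    ⟪Finsupp.linearCombination ℂ δ c, Finsupp.linearCombination ℂ δ (Finsupp.mapDomain τ c')⟫_ℂ =
      ∑ x ∈ c.support, ∑ y ∈ c'.support, conj (c x) * c' y * ⟪δ x, δ (τ y)⟫_ℂ := by
  rw [Finsupp.linearCombination_mapDomain, inner_lc_lc']
  rfl

/-- The combination with the single coefficient `1` at `x` is the kernel vector `δₓ`. [folklore] -/
theorem lc_single (δ : X → H) (x : X) :
    Finsupp.linearCombination ℂ δ (Finsupp.single x 1) = δ x := by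
  simp

/-- A kernel-symmetric relabelling (`⟪δ_{σx}, δᵧ⟫ = ⟪δₓ, δ_{σy}⟫`) is symmetric on combinations. [folklore] -/
theorem inner_lc_mapDomain_left (δ : X → H) {σ : X → X}
    (hσ : ∀ x y, ⟪δ (σ x), δ y⟫_ℂ = ⟪δ x, δ (σ y)⟫_ℂ) (c c' : X →₀ ℂ) :
    ⟪Finsupp.linearCombination ℂ δ (Finsupp.mapDomain σ c), Finsupp.linearCombination ℂ δ c'⟫_ℂ =
      ⟪Finsupp.linearCombination ℂ δ c, Finsupp.linearCombination ℂ δ (Finsupp.mapDomain σ c')⟫_ℂ := by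
  have h1 := inner_lc_mapDomain δ σ id c c'
  have h2 := inner_lc_mapDomain δ id σ c c'
  rw [Finsupp.mapDomain_id] at h1 h2
  rw [h1, h2]
  simp only [id, hσ]

/-- A kernel-preserving relabelling (`⟪δ_{ρx}, δ_{ρy}⟫ = ⟪δₓ, δᵧ⟫`) preserves inner products of
combinations. [folklore] -/
theorem inner_lc_mapDomain_mapDomain (δ : X → H) {ρ : X → X}
    (hρ : ∀ x y, ⟪δ (ρ x), δ (ρ y)⟫_ℂ = ⟪δ x, δ y⟫_ℂ) (c c' : X →₀ ℂ) :
    ⟪Finsupp.linearCombination ℂ δ (Finsupp.mapDomain ρ c),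
        Finsupp.linearCombination ℂ δ (Finsupp.mapDomain ρ c')⟫_ℂ =
      ⟪Finsupp.linearCombination ℂ δ c, Finsupp.linearCombination ℂ δ c'⟫_ℂ := by
  rw [inner_lc_mapDomain, inner_lc_lc]
  simp only [hρ]

/-- A kernel-preserving relabelling preserves norms of combinations. [folklore] -/
theorem norm_lc_mapDomain_eq (δ : X → H) {ρ : X → X}
    (hρ : ∀ x y, ⟪δ (ρ x), δ (ρ y)⟫_ℂ = ⟪δ x, δ y⟫_ℂ) (c : X →₀ ℂ) :
    ‖Finsupp.linearCombination ℂ δ (Finsupp.mapDomain ρ c)‖ = ‖Finsupp.linearCombination ℂ δ c‖ := by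
  rw [@norm_eq_sqrt_re_inner ℂ, @norm_eq_sqrt_re_inner ℂ, inner_lc_mapDomain_mapDomain δ hρ]

/-- Entrywise bound for the Gram formula: if `‖⟪δ_{σx}, δ_{τy}⟫‖ ≤ C x y` on the supports then
`‖⟪Σ cₓ δ_{σx}, Σ c'ᵧ δ_{τy}⟫‖ ≤ Σ ‖cₓ‖ ‖c'ᵧ‖ C x y`. [folklore] -/
theorem norm_inner_lc_mapDomain_le (δ : X → H) (σ τ : X → X) (c c' : X →₀ ℂ) {C : X → X → ℝ}
    (hC : ∀ x ∈ c.support, ∀ y ∈ c'.support, ‖⟪δ (σ x), δ (τ y)⟫_ℂ‖ ≤ C x y) :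
    ‖⟪Finsupp.linearCombination ℂ δ (Finsupp.mapDomain σ c),
        Finsupp.linearCombination ℂ δ (Finsupp.mapDomain τ c')⟫_ℂ‖ ≤
      ∑ x ∈ c.support, ∑ y ∈ c'.support, ‖c x‖ * ‖c' y‖ * C x y := by
  rw [inner_lc_mapDomain]
  refine (norm_sum_le _ _).trans (Finset.sum_le_sum fun x hx => (norm_sum_le _ _).trans
    (Finset.sum_le_sum fun y hy => ?_))
  rw [norm_mul, norm_mul, RCLike.norm_conj]
  exact mul_le_mul_of_nonneg_left (hC x hx y hy) (by positivity)

/-! ## Operators determined on the span -/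

/-- Two continuous maps out of `H` that agree on the (dense) combinations of kernel vectors are
equal. [folklore] -/
theorem eq_of_eq_on_lc {F : Type*} [TopologicalSpace F] [T2Space F] (δ : X → H)
    (hδ : DenseRange (Finsupp.linearCombination ℂ δ)) {S S' : H → F} (hS : Continuous S)
    (hS' : Continuous S') (h : ∀ c, S (Finsupp.linearCombination ℂ δ c) = S' (Finsupp.linearCombination ℂ δ c)) :
    S = S' :=
  hδ.equalizer hS hS' (funext h)

/-- Two bounded operators that agree on the combinations of kernel vectors are equal. [folklore] -/
theorem clm_eq_of_eq_on_lc {F : Type*} [NormedAddCommGroup F] [NormedSpace ℂ F] (δ : X → H)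
    (hδ : DenseRange (Finsupp.linearCombination ℂ δ)) {S S' : H →L[ℂ] F}
    (h : ∀ c, S (Finsupp.linearCombination ℂ δ c) = S' (Finsupp.linearCombination ℂ δ c)) :
    S = S' :=
  ContinuousLinearMap.coeFn_injective (eq_of_eq_on_lc δ hδ S.continuous S'.continuous h)

/-- **Bounded relabellings extend** (`LinearMap.extendOfNorm`): if `‖Σ cₓ δ_{σx}‖ ≤ C ‖Σ cₓ δₓ‖`
for all finite `c`, there is a bounded operator `T` on `H` with `T (Σ cₓ δₓ) = Σ cₓ δ_{σx}` and
`‖T ψ‖ ≤ C ‖ψ‖` (Osterwalder–Schrader 1973, text after (4.9); Glimm–Jaffe (6.1.12)). [cite: OsterwalderSchraderCMP1973, §4.1, text after (4.9)] -/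
theorem exists_clm_of_norm_le [CompleteSpace H] (δ : X → H)
    (hδ : DenseRange (Finsupp.linearCombination ℂ δ)) (σ : X → X) {C : ℝ}
    (hC : ∀ c : X →₀ ℂ, ‖Finsupp.linearCombination ℂ δ (Finsupp.mapDomain σ c)‖ ≤
      C * ‖Finsupp.linearCombination ℂ δ c‖) :
    ∃ T : H →L[ℂ] H,
      (∀ c, T (Finsupp.linearCombination ℂ δ c) = Finsupp.linearCombination ℂ δ (Finsupp.mapDomain σ c)) ∧
        ∀ ψ, ‖T ψ‖ ≤ C * ‖ψ‖ := by
  have hC' : ∀ c : X →₀ ℂ, ‖(Finsupp.linearCombination ℂ δ ∘ₗ Finsupp.lmapDomain ℂ ℂ σ) c‖ ≤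
      C * ‖Finsupp.linearCombination ℂ δ c‖ := fun c => by
    simpa only [LinearMap.comp_apply, Finsupp.lmapDomain_apply] using hC c
  refine ⟨(Finsupp.linearCombination ℂ δ ∘ₗ Finsupp.lmapDomain ℂ ℂ σ).extendOfNorm
    (Finsupp.linearCombination ℂ δ), fun c => ?_, fun ψ => ?_⟩
  · rw [LinearMap.extendOfNorm_eq hδ ⟨C, hC'⟩ c, LinearMap.comp_apply, Finsupp.lmapDomain_apply]
  · exact LinearMap.norm_extendOfNorm_apply_le hδ C hC' ψ

/-- The operator of a relabelling maps `δₓ` to `δ_{σx}`. [folklore] -/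
theorem clm_apply_gen (δ : X → H) {σ : X → X} {T : H →L[ℂ] H}
    (hT : ∀ c, T (Finsupp.linearCombination ℂ δ c) = Finsupp.linearCombination ℂ δ (Finsupp.mapDomain σ c))
    (x : X) : T (δ x) = δ (σ x) := by
  rw [← lc_single δ x, hT, Finsupp.mapDomain_single, lc_single]

/-- **Symmetry**: the operator of a kernel-symmetric relabelling is symmetric,
`⟪T φ, ψ⟫ = ⟪φ, T ψ⟫` (Osterwalder–Schrader 1973, (4.7); Glimm–Jaffe Thm. 6.1.3 (ii)). [cite: OsterwalderSchraderCMP1973, §4.1 eq. (4.7)] -/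
theorem inner_clm_left_of_symm (δ : X → H) (hδ : DenseRange (Finsupp.linearCombination ℂ δ))
    {σ : X → X} (hσ : ∀ x y, ⟪δ (σ x), δ y⟫_ℂ = ⟪δ x, δ (σ y)⟫_ℂ) {T : H →L[ℂ] H}
    (hT : ∀ c, T (Finsupp.linearCombination ℂ δ c) = Finsupp.linearCombination ℂ δ (Finsupp.mapDomain σ c))
    (φ ψ : H) : ⟪T φ, ψ⟫_ℂ = ⟪φ, T ψ⟫_ℂ := by
  refine hδ.induction_on φ ?_ fun c => ?_
  · exact isClosed_eq (T.continuous.inner continuous_const) (continuous_id.inner continuous_const)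
  · refine hδ.induction_on ψ ?_ fun c' => ?_
    · exact isClosed_eq (continuous_const.inner continuous_id) (continuous_const.inner T.continuous)
    · rw [hT, hT, inner_lc_mapDomain_left δ hσ]

/-- The operator of a kernel-preserving relabelling is isometric. [cite: OsterwalderSchraderCMP1973, §4.1 eq. (4.5)] -/
theorem norm_clm_apply_of_inner_eq (δ : X → H) (hδ : DenseRange (Finsupp.linearCombination ℂ δ))
    {ρ : X → X} (hρ : ∀ x y, ⟪δ (ρ x), δ (ρ y)⟫_ℂ = ⟪δ x, δ y⟫_ℂ) {U : H →L[ℂ] H}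
    (hU : ∀ c, U (Finsupp.linearCombination ℂ δ c) = Finsupp.linearCombination ℂ δ (Finsupp.mapDomain ρ c))
    (ψ : H) : ‖U ψ‖ = ‖ψ‖ := by
  refine hδ.induction_on ψ ?_ fun c => ?_
  · exact isClosed_eq (continuous_norm.comp U.continuous) continuous_norm
  · rw [hU, norm_lc_mapDomain_eq δ hρ]

/-! ## The Osterwalder–Schrader iteration: contraction on the span -/

/-- `‖Σ cₓ δ_{σ_s x}‖² = Re ⟪Σ cₓ δₓ, Σ cₓ δ_{σ_{2s} x}⟫` for a kernel-symmetric semigroup of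
relabellings (symmetry and the semigroup law). [cite: OsterwalderSchraderCMP1973, §4.1 eq. (4.9)] -/
theorem norm_lc_mapDomain_sq (δ : X → H) (σ : ℝ → X → X)
    (hsymm : ∀ t, 0 ≤ t → ∀ x y, ⟪δ (σ t x), δ y⟫_ℂ = ⟪δ x, δ (σ t y)⟫_ℂ)
    (hadd : ∀ s t, 0 ≤ s → 0 ≤ t → ∀ x, σ (s + t) x = σ s (σ t x)) {s : ℝ} (hs : 0 ≤ s)
    (c : X →₀ ℂ) :
    ‖Finsupp.linearCombination ℂ δ (Finsupp.mapDomain (σ s) c)‖ ^ 2 =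
      RCLike.re ⟪Finsupp.linearCombination ℂ δ c,
        Finsupp.linearCombination ℂ δ (Finsupp.mapDomain (σ (2 * s)) c)⟫_ℂ := by
  rw [← inner_self_eq_norm_sq (𝕜 := ℂ), inner_lc_mapDomain_left δ (hsymm s hs),
    ← Finsupp.mapDomain_comp]
  have : σ s ∘ σ s = σ (2 * s) := funext fun x => by rw [Function.comp_apply, two_mul, hadd s s hs hs]
  rw [this]

/-- **Contraction on the span** (Osterwalder–Schrader 1973, (4.8)–(4.9); Glimm–Jaffe Thm. 6.1.3
(iii)): for a kernel-symmetric semigroup of relabellings `σ_t` (`t ≥ 0`) whose kernel entries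
`⟪δₓ, δ_{σ_t y}⟫` are bounded in `t`, `‖Σ cₓ δ_{σ_t x}‖ ≤ ‖Σ cₓ δₓ‖`. The boundedness replaces the
polynomial growth (4.8) of the distributional setting; the iteration is the tree's
`le_of_sq_le_mul_succ`. [cite: OsterwalderSchraderCMP1973, §4.1 eqs. (4.8)–(4.9)] -/
theorem norm_lc_mapDomain_le (δ : X → H) (σ : ℝ → X → X)
    (hsymm : ∀ t, 0 ≤ t → ∀ x y, ⟪δ (σ t x), δ y⟫_ℂ = ⟪δ x, δ (σ t y)⟫_ℂ)
    (hadd : ∀ s t, 0 ≤ s → 0 ≤ t → ∀ x, σ (s + t) x = σ s (σ t x))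
    (hbdd : ∀ x y, ∃ C : ℝ, ∀ t, 0 ≤ t → ‖⟪δ x, δ (σ t y)⟫_ℂ‖ ≤ C) {t : ℝ} (ht : 0 ≤ t)
    (c : X →₀ ℂ) :
    ‖Finsupp.linearCombination ℂ δ (Finsupp.mapDomain (σ t) c)‖ ≤ ‖Finsupp.linearCombination ℂ δ c‖ := by
  classical
  choose C hC using hbdd
  -- the basic step `a(s)² ≤ ‖v‖ a(2s)`
  have hstep : ∀ s, 0 ≤ s → ‖Finsupp.linearCombination ℂ δ (Finsupp.mapDomain (σ s) c)‖ ^ 2 ≤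
      ‖Finsupp.linearCombination ℂ δ c‖ *
        ‖Finsupp.linearCombination ℂ δ (Finsupp.mapDomain (σ (2 * s)) c)‖ := fun s hs => by
    rw [norm_lc_mapDomain_sq δ σ hsymm hadd hs]
    exact (RCLike.re_le_norm _).trans (norm_inner_le_norm _ _)
  -- the uniform bound `a(s)² ≤ M`
  set M : ℝ := ∑ x ∈ c.support, ∑ y ∈ c.support, ‖c x‖ * ‖c y‖ * C x y
  have hM : ∀ s, 0 ≤ s → ‖Finsupp.linearCombination ℂ δ (Finsupp.mapDomain (σ s) c)‖ ^ 2 ≤ M := by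
    intro s hs
    rw [norm_lc_mapDomain_sq δ σ hsymm hadd hs]
    refine (RCLike.re_le_norm _).trans ?_
    have h := norm_inner_lc_mapDomain_le δ id (σ (2 * s)) c c (C := C)
      (fun x _ y _ => hC x y (2 * s) (by positivity))
    rwa [Finsupp.mapDomain_id] at h
  have hM' : ∀ s, 0 ≤ s → ‖Finsupp.linearCombination ℂ δ (Finsupp.mapDomain (σ s) c)‖ ≤ max M 1 := by
    intro s hs
    set a := ‖Finsupp.linearCombination ℂ δ (Finsupp.mapDomain (σ s) c)‖
    have ha : 0 ≤ a := norm_nonneg _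
    rcases le_or_gt a 1 with h1 | h1
    · exact h1.trans (le_max_right _ _)
    · have : a ≤ a ^ 2 := by nlinarith
      exact (this.trans (hM s hs)).trans (le_max_left _ _)
  -- the iteration along `t, 2t, 4t, …`
  set a : ℕ → ℝ := fun n => ‖Finsupp.linearCombination ℂ δ (Finsupp.mapDomain (σ (2 ^ n * t)) c)‖ with ha
  have h0 : a 0 = ‖Finsupp.linearCombination ℂ δ (Finsupp.mapDomain (σ t) c)‖ := by simp [a]
  rw [← h0]
  refine Literature.MathematicalPhysics.QuantumLattice.le_of_sq_le_mul_succ (norm_nonneg _)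
    (fun n => hM' _ (by positivity)) fun n => ?_
  have := hstep (2 ^ n * t) (by positivity)
  simpa [a, pow_succ, mul_comm, mul_assoc, mul_left_comm] using this

/-! ## Strong continuity of isometric relabelling groups -/

section Group

variable {E : Type*} [SeminormedAddCommGroup E]

/-- Weak continuity on the span: `a ↦ ⟪Σ cₓ δₓ, U(a) Σ c'ᵧ δᵧ⟫` is continuous as soon as the
kernel entries `a ↦ ⟪δₓ, δ_{ρ_a y}⟫` are. [folklore] -/
theorem continuous_inner_lc_clm (δ : X → H) {ρ : E → X → X} {U : E → H →L[ℂ] H}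
    (hU : ∀ a c, U a (Finsupp.linearCombination ℂ δ c) =
      Finsupp.linearCombination ℂ δ (Finsupp.mapDomain (ρ a) c))
    (hcont : ∀ x y, Continuous fun a => ⟪δ x, δ (ρ a y)⟫_ℂ) (c c' : X →₀ ℂ) :
    Continuous fun a => ⟪Finsupp.linearCombination ℂ δ c, U a (Finsupp.linearCombination ℂ δ c')⟫_ℂ := by
  simp only [hU, inner_lc_lc_mapDomain]
  exact continuous_finsetSum _ fun x _ => continuous_finsetSum _ fun y _ =>
    continuous_const.mul (hcont x y)

/-- `‖U φ − φ‖² = 2‖φ‖² − 2 Re ⟪φ, U φ⟫` for an isometric `U`. [folklore] -/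
theorem norm_clm_sub_sq {U : H →L[ℂ] H} (hU : ∀ ψ, ‖U ψ‖ = ‖ψ‖) (φ : H) :
    ‖U φ - φ‖ ^ 2 = 2 * ‖φ‖ ^ 2 - 2 * RCLike.re ⟪φ, U φ⟫_ℂ := by
  rw [@norm_sub_sq ℂ, hU, ← inner_conj_symm, RCLike.conj_re]
  ring

/-- Strong continuity at `0` on the span: `U(a) v → v` as `a → 0` for `v = Σ cₓ δₓ`, for an
isometric family `U(a)` relabelling the kernel vectors with `U(0) = 1` and continuous kernel
entries. [folklore] -/
theorem tendsto_clm_lc_nhds_zero (δ : X → H) {ρ : E → X → X} {U : E → H →L[ℂ] H}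
    (hU : ∀ a c, U a (Finsupp.linearCombination ℂ δ c) =
      Finsupp.linearCombination ℂ δ (Finsupp.mapDomain (ρ a) c))
    (hUn : ∀ a ψ, ‖U a ψ‖ = ‖ψ‖) (hU0 : U 0 = 1)
    (hcont : ∀ x y, Continuous fun a => ⟪δ x, δ (ρ a y)⟫_ℂ) (c : X →₀ ℂ) :
    Tendsto (fun a => U a (Finsupp.linearCombination ℂ δ c)) (𝓝 0)
      (𝓝 (Finsupp.linearCombination ℂ δ c)) := by
  set v := Finsupp.linearCombination ℂ δ c
  have hlim : Tendsto (fun a : E => 2 * ‖v‖ ^ 2 - 2 * RCLike.re ⟪v, U a v⟫_ℂ) (𝓝 0) (𝓝 0) := by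
    have hc : Continuous fun a : E => 2 * ‖v‖ ^ 2 - 2 * RCLike.re ⟪v, U a v⟫_ℂ :=
      continuous_const.sub (continuous_const.mul
        (RCLike.continuous_re.comp (continuous_inner_lc_clm δ hU hcont c c)))
    have h0 := hc.tendsto 0
    rw [hU0, one_apply_eq_self, inner_self_eq_norm_sq (𝕜 := ℂ)] at h0
    simpa using h0
  have hsq : Tendsto (fun a : E => ‖U a v - v‖ ^ 2) (𝓝 0) (𝓝 0) := by
    simp only [norm_clm_sub_sq (hUn _)]
    exact hlim
  rw [tendsto_iff_norm_sub_tendsto_zero]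
  have := hsq.sqrt
  simpa [Real.sqrt_sq (norm_nonneg _)] using this

/-- Strong continuity at `0`: `U(a) ψ → ψ` as `a → 0` for every `ψ` (density and `‖U(a)‖ = 1`;
Osterwalder–Schrader 1973, (4.10)). [cite: OsterwalderSchraderCMP1973, §4.1 eq. (4.10)] -/
theorem tendsto_clm_nhds_zero (δ : X → H) (hδ : DenseRange (Finsupp.linearCombination ℂ δ))
    {ρ : E → X → X} {U : E → H →L[ℂ] H}
    (hU : ∀ a c, U a (Finsupp.linearCombination ℂ δ c) =
      Finsupp.linearCombination ℂ δ (Finsupp.mapDomain (ρ a) c))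
    (hUn : ∀ a ψ, ‖U a ψ‖ = ‖ψ‖) (hU0 : U 0 = 1)
    (hcont : ∀ x y, Continuous fun a => ⟪δ x, δ (ρ a y)⟫_ℂ) (ψ : H) :
    Tendsto (fun a => U a ψ) (𝓝 0) (𝓝 ψ) := by
  refine Metric.tendsto_nhds.2 fun ε hε => ?_
  obtain ⟨c, hwd⟩ := hδ.exists_dist_lt ψ (ε := ε / 3) (by positivity)
  filter_upwards [Metric.tendsto_nhds.1 (tendsto_clm_lc_nhds_zero δ hU hUn hU0 hcont c) (ε / 3)
    (by positivity)] with a ha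
  have h1 : dist (U a ψ) (U a (Finsupp.linearCombination ℂ δ c)) =
      dist ψ (Finsupp.linearCombination ℂ δ c) := by
    rw [dist_eq_norm, dist_eq_norm, ← map_sub, hUn]
  calc dist (U a ψ) ψ
      ≤ dist (U a ψ) (U a (Finsupp.linearCombination ℂ δ c)) +
          dist (U a (Finsupp.linearCombination ℂ δ c)) (Finsupp.linearCombination ℂ δ c) +
          dist (Finsupp.linearCombination ℂ δ c) ψ := dist_triangle4 _ _ _ _
    _ < ε / 3 + ε / 3 + ε / 3 := by
        gcongr
        · rw [h1]; exact hwd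
        · rwa [dist_comm]
    _ = ε := by ring

/-- **Strong continuity of an isometric relabelling group**: if moreover `U(a + b) = U(a) U(b)`,
then `a ↦ U(a) ψ` is continuous for every `ψ` (Osterwalder–Schrader 1973, (4.5) with (4.10)). [cite: OsterwalderSchraderCMP1973, §4.1 eq. (4.10)] -/
theorem continuous_clm_apply_of_group (δ : X → H) (hδ : DenseRange (Finsupp.linearCombination ℂ δ))
    {ρ : E → X → X} {U : E → H →L[ℂ] H}
    (hU : ∀ a c, U a (Finsupp.linearCombination ℂ δ c) =
      Finsupp.linearCombination ℂ δ (Finsupp.mapDomain (ρ a) c))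
    (hUn : ∀ a ψ, ‖U a ψ‖ = ‖ψ‖) (hU0 : U 0 = 1) (hUadd : ∀ a b, U (a + b) = U a * U b)
    (hcont : ∀ x y, Continuous fun a => ⟪δ x, δ (ρ a y)⟫_ℂ) (ψ : H) :
    Continuous fun a => U a ψ := by
  refine continuous_iff_continuousAt.2 fun a₀ => ?_
  rw [ContinuousAt, tendsto_iff_norm_sub_tendsto_zero]
  have hb : ∀ a : E, ‖U a ψ - U a₀ ψ‖ = ‖U (a - a₀) ψ - ψ‖ := by
    intro a
    conv_lhs => rw [show a = a₀ + (a - a₀) by abel, hUadd, mul_apply_eq_comp]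
    rw [← map_sub, hUn]
  simp only [hb]
  have h0 : Tendsto (fun a : E => a - a₀) (𝓝 a₀) (𝓝 0) := by
    simpa using (tendsto_id (x := 𝓝 a₀)).sub_const a₀
  have := (tendsto_clm_nhds_zero δ hδ hU hUn hU0 hcont ψ).comp h0
  rw [tendsto_iff_norm_sub_tendsto_zero] at this
  exact this

end Group


/-! ## Strong continuity of contraction semigroups of relabellings -/

section Semigroup

/-- Strong continuity at `0` on the span for a symmetric contraction family `T(t)` relabelling the
kernel vectors, with `T(0) = 1` and continuous kernel entries:
`‖T(t)v − v‖² ≤ 2(‖v‖² − Re ⟪v, T(t) v⟫) → 0` (Glimm–Jaffe Thm. 6.1.3). [cite: GlimmJaffeQP1987, §6.1 Thm. 6.1.3] -/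
theorem tendsto_clm_lc_nhds_zero_of_contraction (δ : X → H) {σ : ℝ → X → X}
    {T : ℝ → H →L[ℂ] H}
    (hT : ∀ t c, T t (Finsupp.linearCombination ℂ δ c) =
      Finsupp.linearCombination ℂ δ (Finsupp.mapDomain (σ t) c))
    (hTn : ∀ t ψ, ‖T t ψ‖ ≤ ‖ψ‖) (hT0 : T 0 = 1) (hTsymm : ∀ t φ ψ, ⟪T t φ, ψ⟫_ℂ = ⟪φ, T t ψ⟫_ℂ)
    (hcont : ∀ x y, Continuous fun t => ⟪δ x, δ (σ t y)⟫_ℂ) (c : X →₀ ℂ) :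
    Tendsto (fun t => T t (Finsupp.linearCombination ℂ δ c)) (𝓝 0)
      (𝓝 (Finsupp.linearCombination ℂ δ c)) := by
  set v := Finsupp.linearCombination ℂ δ c
  have hbound : ∀ t, ‖T t v - v‖ ^ 2 ≤ 2 * (‖v‖ ^ 2 - RCLike.re ⟪v, T t v⟫_ℂ) := by
    intro t
    rw [@norm_sub_sq ℂ, hTsymm]
    have h1 : ‖T t v‖ ^ 2 ≤ ‖v‖ ^ 2 := pow_le_pow_left₀ (norm_nonneg _) (hTn t _) 2
    linarith
  have hlim : Tendsto (fun t => 2 * (‖v‖ ^ 2 - RCLike.re ⟪v, T t v⟫_ℂ)) (𝓝 0) (𝓝 0) := by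
    have hc : Continuous fun t => 2 * (‖v‖ ^ 2 - RCLike.re ⟪v, T t v⟫_ℂ) :=
      continuous_const.mul (continuous_const.sub
        (RCLike.continuous_re.comp (continuous_inner_lc_clm δ hT hcont c c)))
    have h0 := hc.tendsto 0
    rw [hT0, one_apply_eq_self, inner_self_eq_norm_sq (𝕜 := ℂ)] at h0
    simpa using h0
  have hsq : Tendsto (fun t => ‖T t v - v‖ ^ 2) (𝓝 0) (𝓝 0) :=
    squeeze_zero (fun t => by positivity) hbound hlim
  rw [tendsto_iff_norm_sub_tendsto_zero]
  have := hsq.sqrt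
  simpa [Real.sqrt_sq (norm_nonneg _)] using this

/-- Strong continuity at `0` of a symmetric contraction family relabelling the kernel vectors:
`T(t) ψ → ψ` as `t → 0` for every `ψ` (density and `‖T(t)‖ ≤ 1`). [cite: GlimmJaffeQP1987, §6.1 Thm. 6.1.3] -/
theorem tendsto_clm_nhds_zero_of_contraction (δ : X → H)
    (hδ : DenseRange (Finsupp.linearCombination ℂ δ)) {σ : ℝ → X → X} {T : ℝ → H →L[ℂ] H}
    (hT : ∀ t c, T t (Finsupp.linearCombination ℂ δ c) =
      Finsupp.linearCombination ℂ δ (Finsupp.mapDomain (σ t) c))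
    (hTn : ∀ t ψ, ‖T t ψ‖ ≤ ‖ψ‖) (hT0 : T 0 = 1) (hTsymm : ∀ t φ ψ, ⟪T t φ, ψ⟫_ℂ = ⟪φ, T t ψ⟫_ℂ)
    (hcont : ∀ x y, Continuous fun t => ⟪δ x, δ (σ t y)⟫_ℂ) (ψ : H) :
    Tendsto (fun t => T t ψ) (𝓝 0) (𝓝 ψ) := by
  refine Metric.tendsto_nhds.2 fun ε hε => ?_
  obtain ⟨c, hwd⟩ := hδ.exists_dist_lt ψ (ε := ε / 3) (by positivity)
  filter_upwards [Metric.tendsto_nhds.1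
    (tendsto_clm_lc_nhds_zero_of_contraction δ hT hTn hT0 hTsymm hcont c) (ε / 3) (by positivity)]
    with t ht
  have h1 : dist (T t ψ) (T t (Finsupp.linearCombination ℂ δ c)) ≤
      dist ψ (Finsupp.linearCombination ℂ δ c) := by
    rw [dist_eq_norm, dist_eq_norm, ← map_sub]
    exact hTn t _
  calc dist (T t ψ) ψ
      ≤ dist (T t ψ) (T t (Finsupp.linearCombination ℂ δ c)) +
          dist (T t (Finsupp.linearCombination ℂ δ c)) (Finsupp.linearCombination ℂ δ c) +
          dist (Finsupp.linearCombination ℂ δ c) ψ := dist_triangle4 _ _ _ _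
    _ < ε / 3 + ε / 3 + ε / 3 := by
        gcongr
        · exact h1.trans_lt hwd
        · rwa [dist_comm]
    _ = ε := by ring

/-- The semigroup estimate `‖T(t)ψ − T(s)ψ‖ ≤ ‖T(|t − s|)ψ − ψ‖` for a contraction semigroup and
`s, t ≥ 0`. [folklore] -/
theorem norm_clm_sub_clm_le_of_semigroup {T : ℝ → H →L[ℂ] H} (hTn : ∀ t ψ, ‖T t ψ‖ ≤ ‖ψ‖)
    (hTadd : ∀ s t, 0 ≤ s → 0 ≤ t → T (s + t) = T s * T t) {s t : ℝ} (hs : 0 ≤ s) (ht : 0 ≤ t)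
    (ψ : H) : ‖T t ψ - T s ψ‖ ≤ ‖T |t - s| ψ - ψ‖ := by
  wlog hst : s ≤ t generalizing s t
  · rw [norm_sub_rev, abs_sub_comm]
    exact this ht hs (le_of_not_ge hst)
  rw [abs_of_nonneg (sub_nonneg.2 hst)]
  have h' : T t ψ = T s (T (t - s) ψ) := by
    rw [← mul_apply_eq_comp, ← hTadd s (t - s) hs (sub_nonneg.2 hst), add_sub_cancel]
  rw [h', ← map_sub]
  exact hTn s _

/-- **Strong continuity of a symmetric contraction semigroup of relabellings** (Glimm–Jaffe
Thm. 6.1.3; Osterwalder–Schrader 1973, p. 92): with the junk convention `T(t) = T(t ∨ 0)`,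
`t ↦ T(t) ψ` is continuous on `ℝ` for every `ψ`. [cite: GlimmJaffeQP1987, §6.1 Thm. 6.1.3] -/
theorem continuous_clm_apply_of_semigroup (δ : X → H)
    (hδ : DenseRange (Finsupp.linearCombination ℂ δ)) {σ : ℝ → X → X} {T : ℝ → H →L[ℂ] H}
    (hT : ∀ t c, T t (Finsupp.linearCombination ℂ δ c) =
      Finsupp.linearCombination ℂ δ (Finsupp.mapDomain (σ t) c))
    (hTn : ∀ t ψ, ‖T t ψ‖ ≤ ‖ψ‖) (hT0 : T 0 = 1)
    (hTadd : ∀ s t, 0 ≤ s → 0 ≤ t → T (s + t) = T s * T t) (hTmax : ∀ t, T t = T (max t 0))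
    (hTsymm : ∀ t φ ψ, ⟪T t φ, ψ⟫_ℂ = ⟪φ, T t ψ⟫_ℂ)
    (hcont : ∀ x y, Continuous fun t => ⟪δ x, δ (σ t y)⟫_ℂ) (ψ : H) :
    Continuous fun t => T t ψ := by
  have hre : (fun t => T t ψ) = fun t => T (max t 0) ψ := by
    funext t; rw [← hTmax]
  rw [hre]
  refine continuous_iff_continuousAt.2 fun t₀ => ?_
  rw [ContinuousAt, tendsto_iff_norm_sub_tendsto_zero]
  have hb : ∀ t : ℝ, ‖T (max t 0) ψ - T (max t₀ 0) ψ‖ ≤ ‖T |max t 0 - max t₀ 0| ψ - ψ‖ := fun t =>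
    norm_clm_sub_clm_le_of_semigroup hTn hTadd (le_max_right _ _) (le_max_right _ _) ψ
  refine squeeze_zero (fun t => norm_nonneg _) hb ?_
  have h0 : Tendsto (fun t : ℝ => |max t 0 - max t₀ 0|) (𝓝 t₀) (𝓝 0) := by
    have hc : Continuous fun t : ℝ => |max t 0 - max t₀ 0| := by fun_prop
    simpa using hc.tendsto t₀
  have := (tendsto_clm_nhds_zero_of_contraction δ hδ hT hTn hT0 hTsymm hcont ψ).comp h0
  rw [tendsto_iff_norm_sub_tendsto_zero] at this
  exact this

end Semigroup

/-! ## The energy–momentum pair of a kernel-symmetric semigroup and a kernel-preserving group -/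

/-- **Energy–momentum pair from relabellings of kernel vectors** (kernel-level Osterwalder–Schrader
reconstruction; Osterwalder–Schrader 1973, §4.1; Glimm–Jaffe Thm. 6.1.3; Berg–Christensen–Ressel
§4.4). Let `δ : X → H` have dense span, let `σ_t` (`t ∈ ℝ`, `σ_t = σ_{t ∨ 0}`) be a semigroup of
kernel-symmetric relabellings with bounded, continuous kernel entries `⟪δₓ, δ_{σ_t y}⟫`, and let
`ρ_a` (`a ∈ ℝ^d`) be a group of kernel-preserving relabellings commuting with `σ`, trivial on the
time axis, with continuous entries. Then the bounded extensions `T(t) : Σ cₓδₓ ↦ Σ cₓ δ_{σ_t x}`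
and `U(a) : Σ cₓδₓ ↦ Σ cₓ δ_{ρ_a x}` exist and form an `IsEnergyMomentumPair`. [cite: OsterwalderSchraderCMP1973, §4.1 p. 92] -/
theorem exists_isEnergyMomentumPair {d : ℕ} [NeZero d] [CompleteSpace H] (δ : X → H)
    (hδ : DenseRange (Finsupp.linearCombination ℂ δ))
    (σ : ℝ → X → X) (ρ : EuclideanSpace ℝ (Fin d) → X → X)
    (hσ0 : ∀ x, σ 0 x = x)
    (hσadd : ∀ s t, 0 ≤ s → 0 ≤ t → ∀ x, σ (s + t) x = σ s (σ t x))
    (hσmax : ∀ t x, σ t x = σ (max t 0) x)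
    (hσsymm : ∀ t x y, ⟪δ (σ t x), δ y⟫_ℂ = ⟪δ x, δ (σ t y)⟫_ℂ)
    (hσbdd : ∀ x y, ∃ C : ℝ, ∀ t, ‖⟪δ x, δ (σ t y)⟫_ℂ‖ ≤ C)
    (hσcont : ∀ x y, Continuous fun t => ⟪δ x, δ (σ t y)⟫_ℂ)
    (hρ0 : ∀ x, ρ 0 x = x)
    (hρadd : ∀ a b x, ρ (a + b) x = ρ a (ρ b x))
    (hρσ : ∀ a t x, ρ a (σ t x) = σ t (ρ a x))
    (hρinner : ∀ a x y, ⟪δ (ρ a x), δ (ρ a y)⟫_ℂ = ⟪δ x, δ y⟫_ℂ)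
    (hρcont : ∀ x y, Continuous fun a => ⟪δ x, δ (ρ a y)⟫_ℂ)
    (hρsingle : ∀ s x, ρ (EuclideanSpace.single 0 s) x = x) :
    ∃ (T : ℝ → H →L[ℂ] H) (U : EuclideanSpace ℝ (Fin d) → H →L[ℂ] H),
      Literature.Analysis.OperatorTheory.IsEnergyMomentumPair T U ∧
      (∀ t c, T t (Finsupp.linearCombination ℂ δ c) =
        Finsupp.linearCombination ℂ δ (Finsupp.mapDomain (σ t) c)) ∧
      ∀ a c, U a (Finsupp.linearCombination ℂ δ c) =
        Finsupp.linearCombination ℂ δ (Finsupp.mapDomain (ρ a) c) := by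
  -- the contraction property on the span and the operators `T(t)`
  have hcontr : ∀ t (c : X →₀ ℂ), ‖Finsupp.linearCombination ℂ δ (Finsupp.mapDomain (σ t) c)‖ ≤
      1 * ‖Finsupp.linearCombination ℂ δ c‖ := by
    intro t c
    rw [one_mul, show σ t = σ (max t 0) from funext (hσmax t)]
    exact norm_lc_mapDomain_le δ σ (fun s _ => hσsymm s) hσadd
      (fun x y => (hσbdd x y).imp fun C hC s _ => hC s) (le_max_right t 0) c
  choose T hT hTn using fun t => exists_clm_of_norm_le δ hδ (σ t) (hcontr t)
  -- the isometries `U(a)`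
  have hiso : ∀ a (c : X →₀ ℂ), ‖Finsupp.linearCombination ℂ δ (Finsupp.mapDomain (ρ a) c)‖ ≤
      1 * ‖Finsupp.linearCombination ℂ δ c‖ := fun a c => by
    rw [one_mul, norm_lc_mapDomain_eq δ (hρinner a)]
  choose U hU _hUn using fun a => exists_clm_of_norm_le δ hδ (ρ a) (hiso a)
  have hTn' : ∀ t ψ, ‖T t ψ‖ ≤ ‖ψ‖ := fun t ψ => by simpa using hTn t ψ
  have hUn : ∀ a ψ, ‖U a ψ‖ = ‖ψ‖ := fun a => norm_clm_apply_of_inner_eq δ hδ (hρinner a) (hU a)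
  -- algebra of `T`
  have hT0 : T 0 = 1 := clm_eq_of_eq_on_lc δ hδ fun c => by
    rw [hT, one_apply_eq_self, show σ 0 = id from funext hσ0, Finsupp.mapDomain_id]
  have hTadd : ∀ s t, 0 ≤ s → 0 ≤ t → T (s + t) = T s * T t := fun s t hs ht =>
    clm_eq_of_eq_on_lc δ hδ fun c => by
      rw [mul_apply_eq_comp, hT, hT, hT, ← Finsupp.mapDomain_comp,
        show σ (s + t) = σ s ∘ σ t from funext (hσadd s t hs ht)]
  have hTmax : ∀ t, T t = T (max t 0) := fun t =>
    clm_eq_of_eq_on_lc δ hδ fun c => by rw [hT, hT, show σ t = σ (max t 0) from funext (hσmax t)]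
  have hTsymm : ∀ t φ ψ, ⟪T t φ, ψ⟫_ℂ = ⟪φ, T t ψ⟫_ℂ := fun t =>
    inner_clm_left_of_symm δ hδ (hσsymm t) (hT t)
  -- algebra of `U`
  have hU0 : U 0 = 1 := clm_eq_of_eq_on_lc δ hδ fun c => by
    rw [hU, one_apply_eq_self, show ρ 0 = id from funext hρ0, Finsupp.mapDomain_id]
  have hUadd : ∀ a b, U (a + b) = U a * U b := fun a b =>
    clm_eq_of_eq_on_lc δ hδ fun c => by
      rw [mul_apply_eq_comp, hU, hU, hU, ← Finsupp.mapDomain_comp,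
        show ρ (a + b) = ρ a ∘ ρ b from funext (hρadd a b)]
  refine ⟨T, U, ?_, hT, hU⟩
  exact
    { transfer_zero := hT0
      transfer_add := fun s t hs ht => hTadd s t hs ht
      transfer_nonneg := fun t ht => by
        rw [ContinuousLinearMap.nonneg_iff_isPositive, ContinuousLinearMap.isPositive_def']
        refine ⟨?_, fun ψ => ?_⟩
        · rw [ContinuousLinearMap.isSelfAdjoint_iff_isSymmetric]
          exact fun φ ψ => hTsymm t φ ψ
        · have h2 : T t = T (t / 2) * T (t / 2) := by
            rw [← hTadd _ _ (by positivity) (by positivity), add_halves]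
          rw [ContinuousLinearMap.reApplyInnerSelf_apply, h2, mul_apply_eq_comp, hTsymm]
          exact inner_self_nonneg
      norm_transfer_le := fun t _ =>
        ContinuousLinearMap.opNorm_le_bound _ zero_le_one fun ψ => by simpa using hTn' t ψ
      continuousOn_transfer := fun ψ =>
        (continuous_clm_apply_of_semigroup δ hδ hT hTn' hT0 hTadd hTmax hTsymm hσcont ψ).continuousOn
      translate_zero := hU0
      translate_add := hUadd
      norm_translate := hUn
      continuous_translate := fun ψ => continuous_clm_apply_of_group δ hδ hU hUn hU0 hUadd hρcont ψ
      commute := fun t _ a => by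
        change T t * U a = U a * T t
        refine clm_eq_of_eq_on_lc δ hδ fun c => ?_
        rw [mul_apply_eq_comp, mul_apply_eq_comp, hU, hT, hT, hU, ← Finsupp.mapDomain_comp,
          ← Finsupp.mapDomain_comp]
        congr 2
        funext x
        exact (hρσ a t x).symm
      translate_single := fun s => clm_eq_of_eq_on_lc δ hδ fun c => by
        rw [hU, one_apply_eq_self, show ρ (EuclideanSpace.single 0 s) = id from funext (hρsingle s),
          Finsupp.mapDomain_id] }

/-! ## Kernel vectors from a positive semidefinite scalar kernel (Moore / Kolmogorov, Mathlib's `RKHS`) -/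

/-- A scalar kernel `k` with `conj (k y x) = k x y`, packaged as the operator-valued matrix
`(k x y) • 1` over `ℂ →L[ℂ] ℂ`, is Hermitian. [folklore] -/
theorem isHermitian_smul_one (k : X → X → ℂ) (hk : ∀ x y, conj (k y x) = k x y) :
    (Matrix.of fun x y => k x y • (1 : ℂ →L[ℂ] ℂ)).IsHermitian := by
  ext x y : 2
  simp only [Matrix.conjTranspose_apply, Matrix.of_apply, star_smul, star_one]
  rw [← hk x y]
  rfl

/-- **Positive semidefiniteness** of the packaged matrix from the scalar condition
`0 ≤ Re Σₓᵧ conj cₓ cᵧ k(x, y)` on finitely supported `c` (Mathlib's `RKHS.posSemidef_tfae`). [folklore] -/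
theorem posSemidef_smul_one (k : X → X → ℂ) (hk : ∀ x y, conj (k y x) = k x y)
    (hpos : ∀ c : X →₀ ℂ, 0 ≤ (∑ x ∈ c.support, ∑ y ∈ c.support, conj (c x) * c y * k x y).re) :
    (Matrix.of fun x y => k x y • (1 : ℂ →L[ℂ] ℂ)).PosSemidef := by
  have htfae := (RKHS.posSemidef_tfae (K := Matrix.of fun x y => k x y • (1 : ℂ →L[ℂ] ℂ))).out 0 2
  refine htfae.2 ⟨isHermitian_smul_one k hk, fun vv => ?_⟩
  have h := hpos vv
  simp only [Matrix.of_apply, smul_apply, one_apply_eq_self, smul_eq_mul, Finsupp.sum,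
    RCLike.re_to_complex]
  convert h using 2
  refine Finset.sum_congr rfl fun x _ => Finset.sum_congr rfl fun y _ => ?_
  rw [RCLike.inner_apply, map_mul, hk]
  ring

/-- **The Gram identity of the Moore–Aronszajn space** (Mathlib's `RKHS.OfKernel`): the kernel
vectors `δₓ = kerFun x 1` of the reproducing kernel Hilbert space of the packaged matrix satisfy
`⟪δₓ, δᵧ⟫ = k(x, y)`. [cite: BergChristensenRessel1984, §4.4] -/
theorem inner_kerFun_one (k : X → X → ℂ) (hk : ∀ x y, conj (k y x) = k x y)
    [Fact (Matrix.of fun x y => k x y • (1 : ℂ →L[ℂ] ℂ)).PosSemidef] (x y : X) :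
    ⟪RKHS.kerFun (RKHS.OfKernel (Matrix.of fun x y => k x y • (1 : ℂ →L[ℂ] ℂ))) x (1 : ℂ),
      RKHS.kerFun (RKHS.OfKernel (Matrix.of fun x y => k x y • (1 : ℂ →L[ℂ] ℂ))) y (1 : ℂ)⟫_ℂ =
      k x y := by
  rw [← RKHS.kernel_inner, RKHS.OfKernel.kernel_ofKernel]
  simp [hk]

/-- **The kernel vectors of the Moore–Aronszajn space have dense span** (Mathlib's
`RKHS.kerFun_dense`, scalar case). [folklore] -/
theorem denseRange_lc_kerFun_one (Kmat : Matrix X X (ℂ →L[ℂ] ℂ)) [Fact Kmat.PosSemidef] :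
    DenseRange (Finsupp.linearCombination ℂ fun x : X => RKHS.kerFun (RKHS.OfKernel Kmat) x (1 : ℂ)) := by
  rw [DenseRange, ← LinearMap.coe_range, Finsupp.range_linearCombination,
    Submodule.dense_iff_topologicalClosure_eq_top, ← top_le_iff, ← RKHS.kerFun_dense (RKHS.OfKernel Kmat)]
  refine Submodule.topologicalClosure_mono (Submodule.span_le.2 ?_)
  rintro _ ⟨x, v, rfl⟩
  have : RKHS.kerFun (RKHS.OfKernel Kmat) x v = v • RKHS.kerFun (RKHS.OfKernel Kmat) x (1 : ℂ) := by
    rw [← map_smul, smul_eq_mul, mul_one]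
  rw [this]
  exact Submodule.smul_mem _ _ (Submodule.subset_span ⟨x, rfl⟩)

end KernelVectors

end Literature.Analysis.OperatorTheory
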